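import Summits.HodgeConjecture.HodgeConjecture.Theorems.F0P3TowerGlueClassMap
import Summits.HodgeConjecture.HodgeConjecture.Theorems.H413TowerHodgeDecomposition
import HarnessLib

/-!
# FLOOR-0 B4 archimedean desk (P2a) — the three remaining stubs B1a ∕ B1b ∕ B3 of the desk line `Lines/F0_P2aHodgeRealisation.lean`,
# CLOSED BY NAME from theorems already in the tree

Cell hodgecm-mathlib (D-0151), FLOOR 0, crux item H413 = stmt-HodgeConjecture-24833; the F0P2a B4 desk (director s364 ∕ s378: ONE hand folds
the desk line `Cruxes/H413/Lines/F0_P2aHodgeRealisation.lean`, ed. 1, sha16 817ccb29, registered stubs B1a ∕ B1b ∕ B3 ∕ B4).  PROOF lane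
(theorems only: no `def`, no instance, no notation, no named fact, no `sorry`); author F0P2a-p08 (g0); `--supports stmt-HodgeConjecture-24833 --as helper`.
Per the cell's stub-closer protocol no `Lines/` module is imported: the three heads' TYPES are the bodies of
`…Cruxes.H413.F0P2aHodgeRealisation.StubB1aLevelFamiliesOnto` (:235–:246), `…StubB1bRegimeFormsTransportBack` (:256–:259) and
`…StubB3TowerHodgeSpanning` (:271–:275) BINDER FOR BINDER, so that the registrar's folds
`stub_B1a_levelFamiliesOnto := F0P2aStubsB1aB1bB3Holds.stubB1a_holds`, `stub_B1b_regimeFormsTransportBack := ….stubB1b_holds`,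
`stub_B3_towerHodgeSpanning := ….stubB3_holds` are one-liners (B4 is the sibling file `Theorems/P4aStubM3CohClassMapWithFormulas.stubB4_holds`,
A-p12 (g12); with it the line's `sorry` count goes 4 → 0 and its heads `stubT2_of` ∕ `stubS1_of` ∕ `stubU1_of` ∕ `H413_of_F0P2a` become unconditional
in the B-stubs).

Content — each stub is a REPACKAGING of a theorem that landed while ∕ after the line was cut (PLAN-P2a v2 §0, §5; PLAN-F0P4a v1.2 §1):
* **B1a** (levelwise Matsushima surjectivity on the regime model: every level-`Γ` family `c` of `(1,0)`-classes is the cohomological family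
  `towerFamily G` of a saturated cuspidal cotangent form `G ∈ cuspCotSat V hV Γ.K`) ⇐ F0P3-p01's ★ `CuspCot.towerFamily_glue`
  (`Theorems/F0P3TowerGlueClassMap`: `G := toRegimeFun (glue c)`, ★ `toRegimeFun_glue_mem_cuspCotSat`), the family hypothesis being
  `c ∈ H10L` by ★ `TowerConj.mem_H10L_iff`;
* **B1b** (transport back from the regime model: every `G ∈ cuspCotSat V hV K`, `K` open, is `toRegimeFun f` of an adelic holomorphic cotangent
  form `f` for the factor of record) ⇐ A-p17's ★ `CuspCot.cuspCotSat_le_map_toRegimeFun` (`Theorems/H413HolCotFormsOfModel`);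
* **B3** (the tower is spanned by its `(1,0)`-part and the conjugate of it) ⇐ A-p19's ★ `TowerConj.exists_H10T_add_conjT`
  (`Theorems/H413TowerHodgeDecomposition`).

HC_CM is proved only modulo the 7 printed citations until rung 0 closes; this file closes three floor-0 desk stubs by name and proves nothing else.

## References
* [BorelWallach2000] A. Borel, N. Wallach, *Continuous cohomology, discrete subgroups, and representations of reductive groups*, 2nd ed.,
  Math. Surveys Monogr. 67 (2000) — VII 2.10, VII 3.2, XIII 1.2.
* [VoisinHodgeI2002] C. Voisin, *Hodge Theory and Complex Algebraic Geometry I*, CUP 2002 — §7.1, Cor. 7.6.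
* [BorelJacquet1979] A. Borel, H. Jacquet, *Automorphic forms and automorphic representations*, PSPM 33.1 (1979) — §4.1–§4.2.
* [DeligneHodgeII1971] P. Deligne, *Théorie de Hodge II*, Publ. Math. IHÉS 40 (1971) — 1.2.5.
* Tree: ★ `Theorems/F0P3TowerGlueClassMap` ∕ `F0P3TowerGlue` (F0P3-p01), ★ `Theorems/H413HolCotFormsOfModel` (A-p17), ★ `Theorems/H413TowerConj` ∕
  `H413TowerHodgeDecomposition` (A-p19), ★ `Theorems/H413CuspCot{Components,Transport,Tower,ClassMap,Pin}` (A-p13).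
-/

set_option autoImplicit false
set_option linter.dupNamespace false

noncomputable section

namespace Summit.HodgeConjecture.HodgeConjecture.Cruxes.H413.F0P2aStubsB1aB1bB3Holds

open MulAction NumberField
open Literature.NumberTheory.Automorphic Literature.NumberTheory.Automorphic.UnitaryGroup
open Literature.AlgebraicGeometry.HodgeTheory Literature.AlgebraicGeometry.ShimuraVarieties
open Literature.NumberTheory.Automorphic.PicardCM
open Literature.NumberTheory.Transcendental (Arapura2012_Cor_15_4_6)
open HodgeCM HodgeCM.Model HodgeCM.Model.TowerLevel HodgeCM.Model.TowerCarrier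
open Summit.HodgeConjecture.CorCM Summit.HodgeConjecture.CorCM.Model
open Summit.HodgeConjecture.HodgeConjecture.Cruxes.H413.CohFormsCarriers
open Summit.HodgeConjecture.HodgeConjecture.Cruxes.H413.CuspCot
open Summit.HodgeConjecture.HodgeConjecture.Cruxes.H413.TowerConj (H10T H10L conjT mem_H10L_iff exists_H10T_add_conjT)

/-! ## B1a — levelwise Matsushima surjectivity on the regime model -/

/-- **P2a stub B1a `StubB1aLevelFamiliesOnto`, closed by name** (the body of `…Cruxes.H413.F0P2aHodgeRealisation.StubB1aLevelFamiliesOnto`,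
binder for binder): for a level-`Γ` family `c` all of whose components are `(1,0)`-classes, the glued holomorphic cotangent form read on the
regime model, `G := toRegimeFun (glue c) ∈ cuspCotSat V hV Γ.K` (★ `toRegimeFun_glue_mem_cuspCotSat`), has cohomological family
`towerFamily G = c` (★ `towerFamily_glue`). [cite: BorelWallach2000, VII 3.2; XIII 1.2] [cite: VoisinHodgeI2002, Cor. 7.6] -/
theorem stubB1a_holds :
    ∀ (F : HodgeCM.CMField) {ι₁ : F →+* ℂ} (V : HodgeCM.HermSpace3 F ι₁) (hV : IsAnisotropic F (HodgeCM.HermSpace3.Hm V))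
      (hHD : exists_isReal_hodgeModel) (hI : hodgePQ_independent_of_hodgeModel) (h₁ : BallQuotientUniformised) (h₃ : CMAbelianVarietyRealised)
      (hA : Arapura2012_Cor_15_4_6) (Γ : Level V) (hΓ : Γ.BelowConjThree)
      (c : ↥(HodgeCM.Model.TowerLevel.towerLevel hHD hI (ballQuotientUniformisedDatum_of h₁) h₃ hA Γ hΓ)),
      (∀ h : ↥(HodgeCM.HermSpace3.adelicFin V),
          (c : Π h : ↥(HodgeCM.HermSpace3.adelicFin V), HodgeCM.Model.TowerLevel.W hHD hI (ballQuotientUniformisedDatum_of h₁) h₃ Γ hΓ h) h ∈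
            ((HodgeCM.Model.universeOf hHD hI (ballQuotientUniformisedDatum_of h₁) h₃).hodge
                ((HodgeCM.Model.universeOf hHD hI (ballQuotientUniformisedDatum_of h₁) h₃).pms F ι₁ V (Γ.conj h hΓ)) 1).F 1) →
        ∃ (G : (V.latticeModel printFact_unitaryCompact_holds).G → (Fin 2 → ℂ)) (hG : G ∈ cuspCotSat V hV Γ.K),
          towerFamily hHD hI h₁ h₃ hΓ hG =
            (c : Π h : ↥(HodgeCM.HermSpace3.adelicFin V), HodgeCM.Model.TowerLevel.W hHD hI (ballQuotientUniformisedDatum_of h₁) h₃ Γ hΓ h) := by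
  intro F ι₁ V hV hHD hI h₁ h₃ hA Γ hΓ c hc10
  have hc : c ∈ H10L hHD hI (ballQuotientUniformisedDatum_of h₁) h₃ hA Γ hΓ :=
    (mem_H10L_iff hHD hI (ballQuotientUniformisedDatum_of h₁) h₃ hA c).2 hc10
  exact ⟨_, toRegimeFun_glue_mem_cuspCotSat hHD hI h₁ h₃ hA hV c hc,
    congrArg Subtype.val (towerFamily_glue hHD hI h₁ h₃ hA hV c hc)⟩

/-! ## B1b — transport back from the regime model -/

/-- **P2a stub B1b `StubB1bRegimeFormsTransportBack`, closed by name** (the body of `…F0P2aHodgeRealisation.StubB1bRegimeFormsTransportBack`,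
binder for binder): at an OPEN level `K`, every saturated cuspidal cotangent form on the regime model is `toRegimeFun f` of a holomorphic
cotangent form `f` for the factor of record (★ `cuspCotSat_le_map_toRegimeFun`, `f := G ∘ e`). [cite: BorelJacquet1979, §4.1–§4.2]
[cite: BorelWallach2000, XIII 1.2] -/
theorem stubB1b_holds :
    ∀ (F : HodgeCM.CMField) {ι₁ : F →+* ℂ} (V : HodgeCM.HermSpace3 F ι₁) (hV : IsAnisotropic F (HodgeCM.HermSpace3.Hm V))
      (K : Subgroup ↥(HodgeCM.HermSpace3.adelicFin V)), IsOpen (K : Set ↥(HodgeCM.HermSpace3.adelicFin V)) →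
      ∀ G ∈ cuspCotSat V hV K, ∃ f ∈ holCotForms (archFactorOf F V), toRegimeFun F V hV f = G := by
  intro F ι₁ V hV K hKo G hG
  obtain ⟨f, hf, hfG⟩ := Submodule.mem_map.1 (cuspCotSat_le_map_toRegimeFun hKo hG)
  exact ⟨f, hf, hfG⟩

/-! ## B3 — the tower is spanned by its `(1,0)`-part and the conjugate of it -/

/-- **P2a stub B3 `StubB3TowerHodgeSpanning`, closed by name** (the body of `…F0P2aHodgeRealisation.StubB3TowerHodgeSpanning`, binder for
binder): every class of the tower `H = colim_K ⊕_h H¹(P_{Γ_h}; ℂ)` is `x + conjT y` with `x, y ∈ H10T` (★ `exists_H10T_add_conjT`: weight-one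
Hodge decomposition levelwise, transported along the transitions). [cite: DeligneHodgeII1971, 1.2.5] [cite: VoisinHodgeI2002, §7.1 and Cor. 7.6]
[cite: BorelWallach2000, VII 2.10] -/
theorem stubB3_holds :
    ∀ (F : HodgeCM.CMField) {ι₁ : F →+* ℂ} (V : HodgeCM.HermSpace3 F ι₁)
      (hHD : exists_isReal_hodgeModel) (hI : hodgePQ_independent_of_hodgeModel) (hU : BallQuotientUniformisedDatum) (h₃ : CMAbelianVarietyRealised)
      (hA : Arapura2012_Cor_15_4_6) (z : Tower hHD hI hU h₃ hA V),
      ∃ x ∈ H10T hHD hI hU h₃ hA V, ∃ y ∈ H10T hHD hI hU h₃ hA V, z = x + conjT hHD hI hU h₃ hA V y := by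
  intro F ι₁ V hHD hI hU h₃ hA z
  obtain ⟨a, b, ha, hb, hz⟩ := exists_H10T_add_conjT hHD hI hU h₃ hA V z
  exact ⟨a, ha, b, hb, hz⟩

end Summit.HodgeConjecture.HodgeConjecture.Cruxes.H413.F0P2aStubsB1aB1bB3Holds

end
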